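import Summits.ResolutionOfSingularities.ResolutionOfSingularities.Theorems.PurelyInseparableDim4SpivakovskyStrategy
import HarnessLib

/-!
# [OURS · res-dim4-pi PR-9c, part 3] Spivakovsky's Lemma 2: one move of the strategy, read on generator sets

Cell `res-dim4-pi` (D-0157 DOOR 2), brick **PR-9c / NEED-FACT «Spivakovsky 1983»** (desk WORD #25 (e); seat
`res-dim4-p-11`, lead).  Def-free sequel of `…SpivakovskyDefs` / `…SpivakovskyStrategy`.  Source: M. Spivakovsky,
*A solution to Hironaka's polyhedra game*, Arithmetic and Geometry II (Progr. Math. 36, 1983) 419–432, §III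
Lemma 2 [cite: Spivakovsky1983, §III Lemma 2 (a)(b)(c) and Claim (1)].

Let `G` be a good position on `I` with `d(G) ≥ 1` and `d(G̃) ≠ 0`, `Γ = strat I G` the strategy's (permissible)
choice, `i ∈ Γ` player B's answer and `G' = σ_{Γ,i}(G)`.  On generator sets:

* §1 the new `ω'`: `ω'_k = ω_k` (`k ≠ i`), `ω'_i = d_Γ(G) − 1`; `d_Γ(G) = d(G̃) + Σ_Γ ω` (Lemma 1 (b));
  **Claim (1)**: `σ_{Γ,i}(g) − ω' = σ̃(g̃)` with `σ̃(x̃)_i = Σ_Γ x̃ − d(G̃)` (`sub_omega_move_self/_of_ne`);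
* §2 **Lemma 2 (a)** `dt_image_move_le : d(G̃') ≤ d(G̃)` (sharper: `≤ d(G̃) − ṽ_i` for every minimiser `v`),
  **Lemma 2 (b)** `dt_image_move_lt_of_mem_Sset` (`i ∈ S(G)` ⇒ strict drop), `not_mem_Sset_of_dt_eq`,
  `Sset_subset_Sset_image_move` (`d(G̃') = d(G̃)` ⇒ `S(G) ⊆ S(G')`);
* §3 **Lemma 2 (c)** `Hset_image_move`, `derive_image_move`: if moreover `S(G') = S(G)` then the derived
  generator set moves by the level-1 strategy: `G'₁ = σ_{Γ₁,i}(G₁)` with `Γ₁ = strat I₁ G₁` — a LITERAL identity of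
  finite sets (the source's `Δ'₁ = [σ_{Γ₁,i}(Δ₁)]`), and `strat I G' = S(G) ∪ strat I₁ G'₁`.

[OURS · counted 0 · AI work weaker than expert review] Kernel transcription of a 1983 combinatorial theorem used by
OUR frame's spine game; NOTHING here is a theorem about resolution of singularities in dimension ≥ 4 / characteristic
`p`. bears_on: LADDER-RESOLUTION:D157-DOOR2 (res-dim4-pi · PR-9c). Supports stmt-ResolutionOfSingularities-16155 (helper).
-/

set_option linter.dupNamespace false -- mandated namespace of this single-conjunct summit

open Finset
open scoped BigOperators

namespace Summit.ResolutionOfSingularities.ResolutionOfSingularities.Theorems.PIDim4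

namespace Spivakovsky

variable {σ : Type} [Fintype σ] [DecidableEq σ]

section Move

variable {I Γ : Finset σ} {G : Pos σ} {i : σ}

/-! ## §1 The new `ω` and Claim (1) -/

/-- `ω'_k = ω_k` for `k ≠ i`: the move changes only the `i`-th coordinate.
[cite: Spivakovsky1983, §III proof of Claim (1)] -/
theorem omega_image_move_of_ne (hG : G.Nonempty) {k : σ} (hk : k ≠ i) :
    omega (G.image (move Γ i)) k = omega G k := by
  apply le_antisymm
  · obtain ⟨g, hg, hgk⟩ := exists_omega_eq hG k
    calc omega (G.image (move Γ i)) k ≤ move Γ i g k := omega_le (Finset.mem_image_of_mem _ hg) k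
      _ = omega G k := by rw [move_apply_of_ne Γ hk, hgk]
  · apply le_omega (hG.image _) k
    intro y hy
    obtain ⟨g, hg, rfl⟩ := Finset.mem_image.mp hy
    rw [move_apply_of_ne Γ hk]
    exact omega_le hg k

/-- `ω'_i = d_Γ(G) − 1`. [cite: Spivakovsky1983, §III Lemma 3 (ω'_i = Σ_Γ ω_j − 1) and Claim (1)] -/
theorem omega_image_move_self (hG : G.Nonempty) : omega (G.image (move Γ i)) i = dG Γ G - 1 := by
  apply le_antisymm
  · obtain ⟨g, hg, hgd⟩ := exists_dG_eq Γ hG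
    calc omega (G.image (move Γ i)) i ≤ move Γ i g i := omega_le (Finset.mem_image_of_mem _ hg) i
      _ = dG Γ G - 1 := by rw [move_apply_self, hgd]
  · apply le_omega (hG.image _) i
    intro y hy
    obtain ⟨g, hg, rfl⟩ := Finset.mem_image.mp hy
    rw [move_apply_self]
    exact sub_le_sub_right (dG_le Γ hg) _

/-- For `Γ ⊆ I` and `g ∈ G`: `Σ_Γ g̃ ≤ Σ_I g̃`. [folklore] -/
theorem sum_tilde_le_of_subset (hΓ : Γ ⊆ I) {g : σ → ℚ} (hg : g ∈ G) :
    ∑ j ∈ Γ, (g - omega G) j ≤ ∑ j ∈ I, (g - omega G) j :=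
  Finset.sum_le_sum_of_subset_of_nonneg hΓ fun k _ _ => tilde_nonneg (sub_omega_mem_tilde hg) k

/-- **`d_Γ(G) = d(G̃) + Σ_Γ ω`** for the strategy's `Γ` (Lemma 1 (b): `d_Γ(G̃) = d(G̃)`).
[cite: Spivakovsky1983, §III Lemma 1 (b), Claim (1)] -/
theorem dG_strat_eq (hgood : Good I G) (hd : 1 ≤ dG I G) (hdt : dt I G ≠ 0) :
    dG (strat I G) G = dt I G + ∑ j ∈ strat I G, omega G j := by
  have hG := hgood.1
  apply le_antisymm
  · obtain ⟨v, hv, hvd⟩ := exists_dG_eq I hG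
    have h1 : ∑ j ∈ strat I G, (v - omega G) j ≤ dt I G := by
      rw [← sum_tilde_eq_dt_of_min hG hvd]
      exact sum_tilde_le_of_subset (strat_subset hgood hd) hv
    calc dG (strat I G) G ≤ ∑ j ∈ strat I G, v j := dG_le _ hv
      _ = ∑ j ∈ strat I G, (v - omega G) j + ∑ j ∈ strat I G, omega G j := by
          rw [sum_sub_omega]; ring
      _ ≤ dt I G + ∑ j ∈ strat I G, omega G j := by linarith
  · apply le_dG _ hG
    intro g hg
    have h1 := dt_le_sum_strat_tilde hgood hd hdt hg
    rw [sum_sub_omega] at h1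
    linarith

/-- **Claim (1), off the pivot**: `(σ_{Γ,i}(g) − ω')_k = g̃_k` for `k ≠ i`. [cite: Spivakovsky1983, §III Claim (1)] -/
theorem sub_omega_move_of_ne (hG : G.Nonempty) {g : σ → ℚ} {k : σ} (hk : k ≠ i) :
    (move Γ i g - omega (G.image (move Γ i))) k = (g - omega G) k := by
  simp only [Pi.sub_apply, move_apply_of_ne Γ hk, omega_image_move_of_ne hG hk]

/-- **Claim (1), at the pivot**: `(σ_{Γ,i}(g) − ω')_i = Σ_Γ g̃ − d(G̃)` for the strategy's `Γ`.
[cite: Spivakovsky1983, §III Claim (1)] -/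
theorem sub_omega_move_self (hgood : Good I G) (hd : 1 ≤ dG I G) (hdt : dt I G ≠ 0) (g : σ → ℚ) :
    (move (strat I G) i g - omega (G.image (move (strat I G) i))) i =
      ∑ j ∈ strat I G, (g - omega G) j - dt I G := by
  simp only [Pi.sub_apply, move_apply_self, omega_image_move_self hgood.1, dG_strat_eq hgood hd hdt,
    Finset.sum_sub_distrib]
  ring

/-- The tilde-sum of a moved generator: `|σ(g) − ω'|_I = Σ_{I∖i} g̃ + (Σ_Γ g̃ − d(G̃))`.
[cite: Spivakovsky1983, §III proof of Lemma 2 (a)] -/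
theorem sum_sub_omega_move (hgood : Good I G) (hd : 1 ≤ dG I G) (hdt : dt I G ≠ 0)
    (hi : i ∈ strat I G) (g : σ → ℚ) :
    ∑ k ∈ I, (move (strat I G) i g - omega (G.image (move (strat I G) i))) k =
      ∑ k ∈ I.erase i, (g - omega G) k + (∑ j ∈ strat I G, (g - omega G) j - dt I G) := by
  have hiI : i ∈ I := strat_subset hgood hd hi
  rw [← Finset.add_sum_erase I _ hiI, sub_omega_move_self hgood hd hdt g, add_comm]
  congr 1
  exact Finset.sum_congr rfl fun k hk => sub_omega_move_of_ne hgood.1 (Finset.ne_of_mem_erase hk)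

/-! ## §2 Lemma 2 (a) and (b) -/

/-- **Lemma 2 (a), sharp form**: for every minimising generator `v` (`|v|_I = d(G)`),
`d(G̃') ≤ d(G̃) − ṽ_i`. [cite: Spivakovsky1983, §III Lemma 2 (a), (2)] -/
theorem dt_image_move_le_sub (hgood : Good I G) (hd : 1 ≤ dG I G) (hdt : dt I G ≠ 0)
    (hi : i ∈ strat I G) {v : σ → ℚ} (hv : v ∈ G) (hvd : ∑ k ∈ I, v k = dG I G) :
    dt I (G.image (move (strat I G) i)) ≤ dt I G - (v - omega G) i := by
  have hG := hgood.1
  have hiI : i ∈ I := strat_subset hgood hd hi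
  have hvt : ∑ k ∈ I, (v - omega G) k = dt I G := sum_tilde_eq_dt_of_min hG hvd
  have hΓ : ∑ j ∈ strat I G, (v - omega G) j ≤ dt I G := by
    rw [← hvt]; exact sum_tilde_le_of_subset (strat_subset hgood hd) hv
  have herase : ∑ k ∈ I.erase i, (v - omega G) k = dt I G - (v - omega G) i := by
    rw [← hvt, ← Finset.add_sum_erase I _ hiI]; ring
  calc dt I (G.image (move (strat I G) i))
      ≤ ∑ k ∈ I, (move (strat I G) i v - omega (G.image (move (strat I G) i))) k :=
        dG_le I (sub_omega_mem_tilde (Finset.mem_image_of_mem _ hv))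
    _ = ∑ k ∈ I.erase i, (v - omega G) k + (∑ j ∈ strat I G, (v - omega G) j - dt I G) :=
        sum_sub_omega_move hgood hd hdt hi v
    _ ≤ dt I G - (v - omega G) i := by rw [herase]; linarith

/-- **Lemma 2 (a)**: `d(G̃') ≤ d(G̃)` — A keeps the first numerical character from increasing.
[cite: Spivakovsky1983, §III Lemma 2 (a)] -/
theorem dt_image_move_le (hgood : Good I G) (hd : 1 ≤ dG I G) (hdt : dt I G ≠ 0) (hi : i ∈ strat I G) :
    dt I (G.image (move (strat I G) i)) ≤ dt I G := by
  obtain ⟨v, hv, hvd⟩ := exists_dG_eq I hgood.1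
  have h := dt_image_move_le_sub hgood hd hdt hi hv hvd
  have h0 : 0 ≤ (v - omega G) i := tilde_nonneg (sub_omega_mem_tilde hv) i
  linarith

/-- **Lemma 2 (b), first half (contrapositive)**: if B's answer `i` lies in `S(G)` then `d(G̃') < d(G̃)`.
[cite: Spivakovsky1983, §III Lemma 2 (b)] -/
theorem dt_image_move_lt_of_mem_Sset (hgood : Good I G) (hd : 1 ≤ dG I G) (hdt : dt I G ≠ 0)
    (hi : i ∈ strat I G) (hiS : i ∈ Sset I G) :
    dt I (G.image (move (strat I G) i)) < dt I G := by
  obtain ⟨-, w, hw, hwd, hwi⟩ := mem_Sset_iff.mp hiS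
  have h := dt_image_move_le_sub hgood hd hdt hi hw hwd
  have h0 : 0 < (w - omega G) i := by
    rcases (tilde_nonneg (sub_omega_mem_tilde hw) i).lt_or_eq with h | h
    · exact h
    · exfalso; apply hwi; simp only [Pi.sub_apply] at h; linarith
  linarith

/-- **Lemma 2 (b)**: `d(G̃') = d(G̃) ⇒ i ∉ S(G)`. [cite: Spivakovsky1983, §III Lemma 2 (b)] -/
theorem not_mem_Sset_of_dt_eq (hgood : Good I G) (hd : 1 ≤ dG I G) (hdt : dt I G ≠ 0)
    (hi : i ∈ strat I G) (heq : dt I (G.image (move (strat I G) i)) = dt I G) : i ∉ Sset I G :=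
  fun hiS => absurd heq (ne_of_lt (dt_image_move_lt_of_mem_Sset hgood hd hdt hi hiS))

/-- A minimiser `w` with `w̃_i = 0` moves to a minimiser: `|σ(w) − ω'|_I = Σ_Γ w̃ = d(G̃)`.
[cite: Spivakovsky1983, §III proof of Lemma 2 (b)] -/
theorem sum_move_eq_dG_of_min (hgood : Good I G) (hd : 1 ≤ dG I G) (hdt : dt I G ≠ 0)
    (hi : i ∈ strat I G) (heq : dt I (G.image (move (strat I G) i)) = dt I G)
    {w : σ → ℚ} (hw : w ∈ G) (hwd : ∑ k ∈ I, w k = dG I G) :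
    ∑ k ∈ I, move (strat I G) i w k = dG I (G.image (move (strat I G) i)) := by
  have hG := hgood.1
  have hiI : i ∈ I := strat_subset hgood hd hi
  have hiS := not_mem_Sset_of_dt_eq hgood hd hdt hi heq
  have hwi : (w - omega G) i = 0 := by
    rw [Pi.sub_apply, eq_omega_of_not_mem_Sset hiI hiS hw hwd, sub_self]
  have hwt : ∑ k ∈ I, (w - omega G) k = dt I G := sum_tilde_eq_dt_of_min hG hwd
  have hle : ∑ j ∈ strat I G, (w - omega G) j ≤ dt I G := by
    rw [← hwt]; exact sum_tilde_le_of_subset (strat_subset hgood hd) hw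
  have hge : dt I G ≤ ∑ j ∈ strat I G, (w - omega G) j := dt_le_sum_strat_tilde hgood hd hdt hw
  have herase : ∑ k ∈ I.erase i, (w - omega G) k = dt I G - (w - omega G) i := by
    rw [← hwt, ← Finset.add_sum_erase I _ hiI]; ring
  have htilde : ∑ k ∈ I, (move (strat I G) i w - omega (G.image (move (strat I G) i))) k = dt I G := by
    rw [sum_sub_omega_move hgood hd hdt hi w, herase, hwi]; linarith
  rw [sum_sub_omega] at htilde
  have h2 := dt_eq I (hG.image (move (strat I G) i))
  rw [heq] at h2
  linarith

/-- **Lemma 2 (b), second half**: `d(G̃') = d(G̃) ⇒ S(G) ⊆ S(G')`. [cite: Spivakovsky1983, §III Lemma 2 (b)] -/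
theorem Sset_subset_Sset_image_move (hgood : Good I G) (hd : 1 ≤ dG I G) (hdt : dt I G ≠ 0)
    (hi : i ∈ strat I G) (heq : dt I (G.image (move (strat I G) i)) = dt I G) :
    Sset I G ⊆ Sset I (G.image (move (strat I G) i)) := by
  intro j hj
  obtain ⟨hjI, w, hw, hwd, hwj⟩ := mem_Sset_iff.mp hj
  have hiS := not_mem_Sset_of_dt_eq hgood hd hdt hi heq
  have hji : j ≠ i := fun h => hiS (h ▸ hj)
  refine mem_Sset_iff.mpr ⟨hjI, move (strat I G) i w, Finset.mem_image_of_mem _ hw,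
    sum_move_eq_dG_of_min hgood hd hdt hi heq hw hwd, ?_⟩
  rwa [move_apply_of_ne _ hji, omega_image_move_of_ne hgood.1 hji]

/-! ## §3 Lemma 2 (c): the derived position moves by the level-1 strategy -/

/-- Scaling commutes with Claim (1): `σ_{Γ,i}(g̃/d) = (σ_{Γ,i}(g) − ω')/d` when `d(G̃') = d(G̃) = d`.
[cite: Spivakovsky1983, §III proof of (4)] -/
theorem move_smul_tilde (hgood : Good I G) (hd : 1 ≤ dG I G) (hdt : dt I G ≠ 0) (g : σ → ℚ) :
    move (strat I G) i ((dt I G)⁻¹ • (g - omega G)) =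
      (dt I G)⁻¹ • (move (strat I G) i g - omega (G.image (move (strat I G) i))) := by
  funext k
  by_cases hk : k = i
  · subst hk
    rw [move_apply_self, Pi.smul_apply, sub_omega_move_self hgood hd hdt g, smul_eq_mul]
    simp only [Pi.smul_apply, smul_eq_mul, ← Finset.mul_sum]
    field_simp
  · rw [move_apply_of_ne _ hk, Pi.smul_apply, Pi.smul_apply, sub_omega_move_of_ne hgood.1 hk]

/-- **`H' = σ_{Γ,i}(H)`** as finite sets, when `d(G̃') = d(G̃)`. [cite: Spivakovsky1983, §III (3)–(4)] -/
theorem Hset_image_move (hgood : Good I G) (hd : 1 ≤ dG I G) (hdt : dt I G ≠ 0)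
    (heq : dt I (G.image (move (strat I G) i)) = dt I G) :
    Hset I (G.image (move (strat I G) i)) = (Hset I G).image (move (strat I G) i) := by
  ext h'
  constructor
  · intro hh'
    apply Finset.mem_image.mpr
    rcases mem_Hset_iff.mp hh' with hg' | ⟨x', hx', hx'eq⟩
    · obtain ⟨g, hg, rfl⟩ := Finset.mem_image.mp hg'
      exact ⟨g, mem_Hset_of_mem hg, rfl⟩
    · obtain ⟨g', hg', rfl⟩ := mem_tilde_iff.mp hx'
      obtain ⟨g, hg, rfl⟩ := Finset.mem_image.mp hg'
      refine ⟨(dt I G)⁻¹ • (g - omega G), smul_tilde_mem_Hset hg, ?_⟩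
      rw [move_smul_tilde hgood hd hdt g, ← heq, hx'eq]
  · intro hh'
    obtain ⟨h, hh, rfl⟩ := Finset.mem_image.mp hh'
    apply mem_Hset_iff.mpr
    rcases mem_Hset_iff.mp hh with hg | ⟨x, hx, rfl⟩
    · exact Or.inl (Finset.mem_image_of_mem _ hg)
    · obtain ⟨g, hg, rfl⟩ := mem_tilde_iff.mp hx
      refine Or.inr ⟨move (strat I G) i g - omega (G.image (move (strat I G) i)),
        sub_omega_mem_tilde (Finset.mem_image_of_mem _ hg), ?_⟩
      rw [heq, move_smul_tilde hgood hd hdt g]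

omit [Fintype σ] in
/-- The filter `Σ_S h < 1` is invariant under the move when `i ∉ S`. [cite: Spivakovsky1983, §III proof of (3)] -/
theorem sum_Sset_move_of_not_mem {S : Finset σ} (hiS : i ∉ S) (h : σ → ℚ) :
    ∑ j ∈ S, move Γ i h j = ∑ j ∈ S, h j :=
  Finset.sum_congr rfl fun j hj => move_apply_of_ne Γ (fun e => hiS (by rw [← e]; exact hj)) h

omit [Fintype σ] in
/-- **Projection commutes with the move**: `P_S(σ_{Γ,i}(h)) = σ_{Γ₁,i}(P_S(h))` for `Γ = S ⊔ Γ₁`, `i ∈ Γ₁ ⊆ J`,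
`Σ_S h < 1`. [cite: Spivakovsky1983, §III proof of (3)] -/
theorem proj_move {S J Γ₁ : Finset σ} (hdisj : Disjoint S Γ₁) (hΓ₁J : Γ₁ ⊆ J)
    (hi : i ∈ Γ₁) {h : σ → ℚ} (hlt : ∑ j ∈ S, h j < 1) :
    proj S J (move (S ∪ Γ₁) i h) = move Γ₁ i (proj S J h) := by
  have hiS : i ∉ S := fun hiS => Finset.disjoint_left.mp hdisj hiS hi
  have hiJ : i ∈ J := hΓ₁J hi
  have hβ : ∑ j ∈ S, move (S ∪ Γ₁) i h j = ∑ j ∈ S, h j := sum_Sset_move_of_not_mem hiS h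
  have hden : (1 - ∑ j ∈ S, h j) ≠ 0 := by linarith
  funext k
  by_cases hk : k = i
  · subst hk
    rw [proj_apply_of_mem hiJ, move_apply_self, move_apply_self, hβ, Finset.sum_union hdisj]
    have hp : ∑ j ∈ Γ₁, proj S J h j = (∑ j ∈ Γ₁, h j) / (1 - ∑ j ∈ S, h j) := by
      rw [Finset.sum_div]
      exact Finset.sum_congr rfl fun j hj => proj_apply_of_mem (hΓ₁J hj) h
    rw [hp]
    field_simp
    ring
  · by_cases hkJ : k ∈ J
    · rw [proj_apply_of_mem hkJ, move_apply_of_ne _ hk, move_apply_of_ne _ hk, hβ, proj_apply_of_mem hkJ]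
    · rw [proj_apply_of_not_mem hkJ, move_apply_of_ne _ hk, proj_apply_of_not_mem hkJ]

/-- **Lemma 2 (c) on generator sets**: if `d(G̃') = d(G̃)`, `S(G') = S(G)` and `G₁ ≠ ∅`, then
`G'₁ = σ_{Γ₁,i}(G₁)` with `Γ₁ = strat I₁ G₁` (the source's `Δ'₁ = [σ_{Γ₁,i}(Δ₁)]`).
[cite: Spivakovsky1983, §III Lemma 2 (c)] -/
theorem derive_image_move (hgood : Good I G) (hd : 1 ≤ dG I G) (hdt : dt I G ≠ 0) (hi : i ∈ strat I G)
    (heq : dt I (G.image (move (strat I G) i)) = dt I G)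
    (hS : Sset I (G.image (move (strat I G) i)) = Sset I G) (hne : (derive I G).Nonempty) :
    derive I (G.image (move (strat I G) i)) =
      (derive I G).image (move (strat (I1 I G) (derive I G)) i) := by
  set Γ₁ := strat (I1 I G) (derive I G) with hΓ₁
  have hlt := card_I1_lt hgood hdt
  have hgood₁ : Good (I1 I G) (derive I G) := good_derive hgood hne
  have hd₁ : 1 ≤ dG (I1 I G) (derive I G) := one_le_dG_derive hgood hd hdt hne
  have hΓ₁J : Γ₁ ⊆ I1 I G := strat_subset hgood₁ hd₁
  have hdisj : Disjoint (Sset I G) Γ₁ := (Finset.disjoint_sdiff (s := Sset I G) (t := I)).mono_right hΓ₁J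
  have hΓ : strat I G = Sset I G ∪ Γ₁ := strat_eq_union hgood hdt hne
  have hiS : i ∉ Sset I G := not_mem_Sset_of_dt_eq hgood hd hdt hi heq
  have hi₁ : i ∈ Γ₁ := by
    have := hi; rw [hΓ, Finset.mem_union] at this
    exact this.resolve_left hiS
  have hI1 : I1 I (G.image (move (strat I G) i)) = I1 I G := by rw [I1, I1, hS]
  -- unfold `derive` on both sides and push the move through filter and projection
  rw [derive, derive, hS, hI1, Hset_image_move hgood hd hdt heq, Finset.filter_image, Finset.image_image,
    Finset.image_image]
  have hfilter : ((Hset I G).filter (fun h => ∑ j ∈ Sset I G, move (strat I G) i h j < 1)) =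
      (Hset I G).filter (fun h => ∑ j ∈ Sset I G, h j < 1) :=
    Finset.filter_congr fun h _ => by rw [sum_Sset_move_of_not_mem hiS]
  rw [hfilter]
  apply Finset.image_congr
  intro h hh
  have hlt1 : ∑ j ∈ Sset I G, h j < 1 := (Finset.mem_filter.mp hh).2
  show (proj (Sset I G) (I1 I G) ∘ move (strat I G) i) h = (move Γ₁ i ∘ proj (Sset I G) (I1 I G)) h
  simp only [Function.comp_apply]
  rw [hΓ]
  exact proj_move hdisj hΓ₁J hi₁ hlt1

/-- After such a move the strategy unfolds with the SAME `S` and the moved derived set: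
`strat I G' = S(G) ∪ strat I₁ G'₁`, and B's answer lies in the level-1 strategy. [cite: Spivakovsky1983, §III p. 432] -/
theorem strat_image_move (hgood : Good I G) (hd : 1 ≤ dG I G) (hdt : dt I G ≠ 0) (hi : i ∈ strat I G)
    (hgood' : Good I (G.image (move (strat I G) i)))
    (heq : dt I (G.image (move (strat I G) i)) = dt I G)
    (hS : Sset I (G.image (move (strat I G) i)) = Sset I G) (hne : (derive I G).Nonempty) :
    strat I (G.image (move (strat I G) i)) =
        Sset I G ∪ strat (I1 I G) (derive I (G.image (move (strat I G) i))) ∧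
      i ∈ strat (I1 I G) (derive I G) := by
  have hdt' : dt I (G.image (move (strat I G) i)) ≠ 0 := by rwa [heq]
  have hne' : (derive I (G.image (move (strat I G) i))).Nonempty := by
    rw [derive_image_move hgood hd hdt hi heq hS hne]; exact hne.image _
  have hI1 : I1 I (G.image (move (strat I G) i)) = I1 I G := by rw [I1, I1, hS]
  have hiS : i ∉ Sset I G := not_mem_Sset_of_dt_eq hgood hd hdt hi heq
  refine ⟨by rw [strat_eq_union hgood' hdt' hne', hS, hI1], ?_⟩
  have := hi
  rw [strat_eq_union hgood hdt hne, Finset.mem_union] at this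
  exact this.resolve_left hiS

end Move

end Spivakovsky

end Summit.ResolutionOfSingularities.ResolutionOfSingularities.Theorems.PIDim4
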